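import Summits.QuantumFields.YangMills.Theorems.UnitScaleTiltProp8ChartDoubleBarDefs
import Summits.QuantumFields.YangMills.Theorems.UnitScaleTiltProp8ChartIterSmall
import HarnessLib

/-!
# Route `UnitScaleTilt`, crux K1 «MinimiserStabilityRegPr» (stmt-QuantumFields-19200), leaf V2′ `stub_halvingStep` — pillar P3 re-based on print's DOUBLE-BAR chart
# (★★OWNER RULING g26-№6, (S3) brick B2): **k-UNIFORM NEAR-FLATNESS OF THE ITERATED DOUBLE-BAR AVERAGE `dbarIterU` ON THE READ TERRITORY**
# ([Balaban1985Averaging] Prop. 4's smallness for `U̿^{(i)}`; the frames do what the coarse gauges `H_i` of ✓`exists_factorisation_emlIterU` did)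

Cell `ym3-torus` (HUMAN RULING D-0037, YM ladder rung R3 — continuum SU(2) YM₃ on the torus is a RUNG, not the Clay problem), width seat `ym-ust-19200-w5` gen 3,
LEAD of (S3) «P3a engine re-read for `chartLogFlat`».  `--supports stmt-QuantumFields-19200 --as helper`; def-free, 0 sorry, standard axioms.

THE ENGINE, ♭ VERSION.  The single-bar engine (✓`…ChartIterSmall`) propagates near-flatness of `Ū^{(i)}(U)` through the levels in FACTORISED form `Ū^{(i)} = S_i^{H_i}`
because the plain sup recursion loses the comb factor `1 + d` per level.  For the double-bar iterate `U̿^{(i)} = dbarIterU i U` (✓`Prop8ChartDoubleBar.dbarIterU`, frames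
recomputed at every level) NO gauge bookkeeping is needed: the block frames `vframeU` conjugate the comb means away at every step, so the ONE-STEP ♭ LETTER
«`‖U̿(c) − 1‖ ≤ L·s + C₁ℓ²s²` whenever `‖U(b) − 1‖ ≤ s` on the bonds of the two blocks of `c`» ((S3) brick B1, the eml-frame transfer of ✓`norm_conj_emlAvgU_sub_one_le`;
taken here as the HYPOTHESIS `hstep` with its constant `C₁ ≥ 2` displayed, so that this file does not wait for B1's constant) iterates directly on the read territory
`S ↦ B⁻¹S`:
* §1 `step_budget_flat` — the arithmetic of the summable second-order corrections (`L·σ + C₁ℓ²σ² ≤ (Lx)(1 + 8C₁ℓ²(Lx))` for `σ = x(1 + 8C₁ℓ²x) ≤ 2x`, `L ≥ 2`);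
* §2 ★ **`norm_dbarIterU_sub_one_le_of_reads`** — for every level `i ≤ m + K`, every set `S` of `i`-sites, every `𝔸ˣ`-field `U` with `‖U(b) − 1‖ ≤ s₀` on the fine bonds
  under `S` and `8C₁·ℓ²·Lⁱ·s₀ ≤ 1`: `‖U̿^{(i)}(e) − 1‖ ≤ Lⁱs₀·(1 + 8C₁ℓ²·Lⁱs₀) ≤ 2·Lⁱ·s₀` on the `i`-bonds with both ends in `S` (`norm_dbarIterU_sub_one_le_two_mul`) —
  k-UNIFORM on the weighted ball where `Lⁱs₀ ≍ L·R` (✓`weighted_read_bound`), with NO comb accumulation (compare single-bar `30ℓ·Lⁱs₀`).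
HONEST SCOPE: the near-flatness half of hCd♭∕hCq♭ (brick B2 part 1); differentiability at reads and the weighted-ball reading (B2 part 2) and the Cauchy estimate (B3)
follow in their own files; `hstep` is brick B1.  NOT a claim about the mass gap.

References: T. Bałaban, CMP **98** (1985) 17–51 [Balaban1985Averaging] (Prop. 3 (122)–(125) p.36, Prop. 4 (134)–(135) p.38, (89) p.31, (110) p.34, (127) p.36,
(150) p.40); CMP **102** (1985) 277–309 [Balaban1985Variational] ((18)–(21) pp.280–281, (44)–(48) p.285).
-/

noncomputable section

open scoped BigOperators
open NormedSpace

namespace Summit.QuantumFields.YangMills.Theorems.Prop8ChartDoubleBar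

open Literature.MathematicalPhysics.QuantumFieldTheory.Balaban1983to89
open T4Continuum BlockAveraging
open B5Eq118OneStroke (iterBlockOf iterBlockOf_succ iterBlockOf_zero)

variable {P : Params}
variable {𝔸 : Type*} [NormedRing 𝔸] [NormedAlgebra ℂ 𝔸] [CompleteSpace 𝔸]

/-! ## §1 The budget arithmetic -/

/-- the summable second-order step: `L·σ + C₁ℓ²σ² ≤ (Lx)(1 + 8C₁ℓ²(Lx))` for `σ = x(1 + 8C₁ℓ²x) ≤ 2x`, `L ≥ 2`, `C₁ ≥ 0`. [folklore] -/
theorem step_budget_flat {L ℓ x s C₁ : ℝ} (hL : 2 ≤ L) (hC₁ : 0 ≤ C₁) (hσ : s = x * (1 + 8 * C₁ * ℓ ^ 2 * x)) (hσ2 : s ≤ 2 * x)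
    (hs0 : 0 ≤ s) : L * s + C₁ * ℓ ^ 2 * s ^ 2 ≤ L * x * (1 + 8 * C₁ * ℓ ^ 2 * (L * x)) := by
  have hss : s ^ 2 ≤ (2 * x) ^ 2 := pow_le_pow_left₀ hs0 hσ2 2
  have h1 : C₁ * ℓ ^ 2 * s ^ 2 ≤ 4 * C₁ * ℓ ^ 2 * x ^ 2 := by nlinarith [mul_le_mul_of_nonneg_left hss (mul_nonneg hC₁ (sq_nonneg ℓ))]
  have h2 : L * s = L * x + 8 * C₁ * ℓ ^ 2 * L * x ^ 2 := by rw [hσ]; ring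
  have hL2 : 8 * L + 4 ≤ 8 * L ^ 2 := by nlinarith
  nlinarith [mul_nonneg (mul_nonneg (mul_nonneg hC₁ (sq_nonneg ℓ)) (sq_nonneg x)) (sub_nonneg.2 hL2)]

/-! ## §2 The iterated double-bar average stays near `1`, uniformly in the level -/

/-- **k-UNIFORM NEAR-FLATNESS OF `U̿^{(i)}` ON THE READ TERRITORY** (see the module docstring; `hstep` = the one-step ♭ letter with constant `C₁`).
[cite: Balaban1985Averaging, Prop. 4 (134)-(135) p.38, Prop. 3 (122)-(125) p.36, (89) p.31] -/
theorem norm_dbarIterU_sub_one_le_of_reads {C₁ : ℝ} (hC₁ : 2 ≤ C₁)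
    (hstep : ∀ (j : ℕ), j + 1 ≤ P.m + P.K → ∀ (S : GaugeField P j 𝔸ˣ) (c : PBond P (j + 1)) (s : ℝ), 0 ≤ s →
      48 * (((P.d + 2) * P.L : ℕ) : ℝ) * s ≤ 1 →
      (∀ b : PBond P j, (blockOf b.src = c.src ∨ blockOf b.src = c.tgt) → (blockOf b.tgt = c.src ∨ blockOf b.tgt = c.tgt) →
        ‖((S b : 𝔸ˣ) : 𝔸) - 1‖ ≤ s) →
      ‖((dbarAvgU S c : 𝔸ˣ) : 𝔸) - 1‖ ≤ (P.L : ℝ) * s + C₁ * (((P.d + 2) * P.L : ℕ) : ℝ) ^ 2 * s ^ 2) :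
    ∀ (i : ℕ), i ≤ P.m + P.K → ∀ (S : Set (Site P i)) (U : GaugeField P 0 𝔸ˣ) (s₀ : ℝ), 0 ≤ s₀ →
      8 * C₁ * (((P.d + 2) * P.L : ℕ) : ℝ) ^ 2 * (P.L : ℝ) ^ i * s₀ ≤ 1 →
      (∀ b : PBond P 0, iterBlockOf i b.src ∈ S → iterBlockOf i b.tgt ∈ S → ‖((U b : 𝔸ˣ) : 𝔸) - 1‖ ≤ s₀) →
      ∀ e : PBond P i, e.src ∈ S → e.tgt ∈ S →
        ‖((dbarIterU i U e : 𝔸ˣ) : 𝔸) - 1‖ ≤ (P.L : ℝ) ^ i * s₀ * (1 + 8 * C₁ * (((P.d + 2) * P.L : ℕ) : ℝ) ^ 2 * ((P.L : ℝ) ^ i * s₀)) := by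
  set ℓ : ℝ := (((P.d + 2) * P.L : ℕ) : ℝ) with hℓ
  have hℓ1 : (1 : ℝ) ≤ ℓ := by
    rw [hℓ]; exact_mod_cast Nat.one_le_iff_ne_zero.mpr (Nat.mul_ne_zero (by omega) (by have := P.hL.2; omega))
  have hℓ0 : (0 : ℝ) ≤ ℓ := by linarith
  have hL2 : (2 : ℝ) ≤ P.L := by exact_mod_cast P.hL.2
  have hL0 : (0 : ℝ) ≤ P.L := by linarith
  have hC₁0 : 0 ≤ C₁ := by linarith
  intro i
  induction i with
  | zero =>
    intro _ S U s₀ hs₀ _ hU e hs ht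
    have h := hU e (by simpa using hs) (by simpa using ht)
    simp only [dbarIterU_zero, pow_zero, one_mul]
    have hB : 0 ≤ 8 * C₁ * ℓ ^ 2 * s₀ := by positivity
    nlinarith
  | succ i ih =>
    intro hi S U s₀ hs₀ hbudget hU
    set x : ℝ := (P.L : ℝ) ^ i * s₀ with hx
    have hx0 : 0 ≤ x := by positivity
    have hpow : (P.L : ℝ) ^ (i + 1) * s₀ = P.L * x := by rw [hx, pow_succ]; ring
    have hbudgetL : 8 * C₁ * ℓ ^ 2 * ((P.L : ℝ) * x) ≤ 1 := by
      have : 8 * C₁ * ℓ ^ 2 * (P.L : ℝ) ^ (i + 1) * s₀ = 8 * C₁ * ℓ ^ 2 * ((P.L : ℝ) * x) := by rw [hx, pow_succ]; ring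
      rwa [this] at hbudget
    have hbudget_i : 8 * C₁ * ℓ ^ 2 * (P.L : ℝ) ^ i * s₀ ≤ 1 := by
      have h1 : 8 * C₁ * ℓ ^ 2 * x ≤ 8 * C₁ * ℓ ^ 2 * ((P.L : ℝ) * x) := by
        have : x ≤ P.L * x := by nlinarith
        exact mul_le_mul_of_nonneg_left this (by positivity)
      rw [hx] at h1; linarith
    have hxsmall : 8 * C₁ * ℓ ^ 2 * x ≤ 1 := by rw [hx]; linarith [hbudget_i]
    -- the induction hypothesis one level down, on `B⁻¹ S`
    set S' : Set (Site P i) := {y | blockOf y ∈ S} with hS'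
    have hU' : ∀ b : PBond P 0, iterBlockOf i b.src ∈ S' → iterBlockOf i b.tgt ∈ S' → ‖((U b : 𝔸ˣ) : 𝔸) - 1‖ ≤ s₀ :=
      fun b hs ht => hU b (by rw [iterBlockOf_succ]; exact hs) (by rw [iterBlockOf_succ]; exact ht)
    have hIH := ih (Nat.le_of_succ_le hi) S' U s₀ hs₀ hbudget_i hU'
    -- the size `σ` at level `i`
    set σ : ℝ := x * (1 + 8 * C₁ * ℓ ^ 2 * x) with hσ
    have hσ0 : 0 ≤ σ := by positivity
    have hσ2 : σ ≤ 2 * x := by rw [hσ]; nlinarith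
    have h48 : 48 * ℓ * σ ≤ 1 := by
      -- `96ℓx ≤ 8C₁ℓ²·L·x ≤ 1` from `C₁ ≥ 2`, `ℓ = (d+2)L ≥ 4`, `L ≥ 2`
      have hℓ4 : (4 : ℝ) ≤ ℓ := by
        rw [hℓ]; exact_mod_cast (show 4 ≤ (P.d + 2) * P.L by have := P.hL.2; nlinarith)
      have h1 : 48 * ℓ * σ ≤ 96 * ℓ * x := by nlinarith [mul_nonneg hℓ0 hx0]
      have h2 : 96 * ℓ * x ≤ 8 * C₁ * ℓ ^ 2 * ((P.L : ℝ) * x) := by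
        have : 96 * ℓ * x = (96 : ℝ) * (ℓ * x) := by ring
        have : 8 * C₁ * ℓ ^ 2 * ((P.L : ℝ) * x) = (8 * C₁ * ℓ * P.L) * (ℓ * x) := by ring
        have hCℓ : (8 : ℝ) ≤ C₁ * ℓ := by nlinarith [mul_le_mul hC₁ hℓ4 (by norm_num) hC₁0]
        have hCℓL : (16 : ℝ) ≤ C₁ * ℓ * P.L := by nlinarith [mul_le_mul hCℓ hL2 (by norm_num) (mul_nonneg hC₁0 hℓ0)]
        have h12 : (96 : ℝ) ≤ 8 * C₁ * ℓ * P.L := by nlinarith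
        nlinarith [mul_nonneg hℓ0 hx0]
      linarith
    -- sizes of the level-`i` double-bar field on the two blocks of a level-`(i+1)` bond with both ends in `S`
    intro c hcs hct
    have hSc : ∀ b : PBond P i, (blockOf b.src = c.src ∨ blockOf b.src = c.tgt) → (blockOf b.tgt = c.src ∨ blockOf b.tgt = c.tgt) →
        ‖((dbarIterU i U b : 𝔸ˣ) : 𝔸) - 1‖ ≤ σ := by
      intro b hbs hbt
      refine hIH b ?_ ?_
      · show blockOf b.src ∈ S
        rcases hbs with h | h <;> rw [h]
        exacts [hcs, hct]
      · show blockOf b.tgt ∈ S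
        rcases hbt with h | h <;> rw [h]
        exacts [hcs, hct]
    have h1 := hstep i hi (dbarIterU i U) c σ hσ0 (by rw [hℓ] at h48; exact h48) hSc
    rw [dbarIterU_succ, hpow]
    refine h1.trans ?_
    exact step_budget_flat hL2 hC₁0 hσ hσ2 hσ0

/-- **COROLLARY: `‖U̿^{(i)}(e) − 1‖ ≤ 2·Lⁱ·s₀`** on the `i`-bonds with both ends in `S`, under the same budget. [cite: Balaban1985Averaging, Prop. 4 (134)-(135) p.38] -/
theorem norm_dbarIterU_sub_one_le_two_mul {C₁ : ℝ} (hC₁ : 2 ≤ C₁)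
    (hstep : ∀ (j : ℕ), j + 1 ≤ P.m + P.K → ∀ (S : GaugeField P j 𝔸ˣ) (c : PBond P (j + 1)) (s : ℝ), 0 ≤ s →
      48 * (((P.d + 2) * P.L : ℕ) : ℝ) * s ≤ 1 →
      (∀ b : PBond P j, (blockOf b.src = c.src ∨ blockOf b.src = c.tgt) → (blockOf b.tgt = c.src ∨ blockOf b.tgt = c.tgt) →
        ‖((S b : 𝔸ˣ) : 𝔸) - 1‖ ≤ s) →
      ‖((dbarAvgU S c : 𝔸ˣ) : 𝔸) - 1‖ ≤ (P.L : ℝ) * s + C₁ * (((P.d + 2) * P.L : ℕ) : ℝ) ^ 2 * s ^ 2)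
    {i : ℕ} (hi : i ≤ P.m + P.K) (S : Set (Site P i)) (U : GaugeField P 0 𝔸ˣ) {s₀ : ℝ} (hs₀ : 0 ≤ s₀)
    (hbudget : 8 * C₁ * (((P.d + 2) * P.L : ℕ) : ℝ) ^ 2 * (P.L : ℝ) ^ i * s₀ ≤ 1)
    (hU : ∀ b : PBond P 0, iterBlockOf i b.src ∈ S → iterBlockOf i b.tgt ∈ S → ‖((U b : 𝔸ˣ) : 𝔸) - 1‖ ≤ s₀)
    (e : PBond P i) (hs : e.src ∈ S) (ht : e.tgt ∈ S) :
    ‖((dbarIterU i U e : 𝔸ˣ) : 𝔸) - 1‖ ≤ 2 * ((P.L : ℝ) ^ i * s₀) := by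
  have h := norm_dbarIterU_sub_one_le_of_reads hC₁ hstep i hi S U s₀ hs₀ hbudget hU e hs ht
  have hx0 : 0 ≤ (P.L : ℝ) ^ i * s₀ := by positivity
  have hsmall : 8 * C₁ * (((P.d + 2) * P.L : ℕ) : ℝ) ^ 2 * ((P.L : ℝ) ^ i * s₀) ≤ 1 := by
    have : 8 * C₁ * (((P.d + 2) * P.L : ℕ) : ℝ) ^ 2 * ((P.L : ℝ) ^ i * s₀) = 8 * C₁ * (((P.d + 2) * P.L : ℕ) : ℝ) ^ 2 * (P.L : ℝ) ^ i * s₀ := by ring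
    rw [this]; exact hbudget
  refine h.trans ?_
  nlinarith

end Summit.QuantumFields.YangMills.Theorems.Prop8ChartDoubleBar

end
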